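import Literature.Analysis.FluidPDE.FluidComputer.ThresholdTransferAngle
import HarnessLib

/-!
# Fluid computer blueprint — threshold gate: the CLOCK SIDE of the transfer window

HONEST FRAMING: low prior, high value-of-information experiment on Tao's machine paradigm; NOT a
claim that NS blows up. Elementary estimates on forced windows of the explicit five-mode
threshold circuit `thresholdCircuit` (`ThresholdGate.lean`); nothing is asserted about any fluid
equation.

## What

The transfer stage of the threshold gate needs, after ignition (`c = C`), a window on which the
trigger stays in a band `c₀ ≤ c ≤ Cm` until the rotor has turned by a prescribed angle `Θt`
(the conversion angle of `ThresholdDrainConversion.lean`). This file proves exactly that, by a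
continuity (maximal-time) argument on the closed condition
`P(t) : c₀ ≤ c(t) ≤ Cm ∧ Θ(t) ≤ Θt`, from budgets that are SIGN-FREE in the carrier `a` and the
conduit `d` (the rotor may overshoot — `a < 0` — without harm):

* `IsForcedWindow.clock_le_affine` — clock ceiling `b(t) ≤ b(0) + (εR² + δ)t`;
* `IsForcedWindow.pairAD_le_angle` — carrier–conduit pair ceiling along the angle:
  `a(t)² + d(t)² ≤ a(0)² + d(0)² + (2μRCm/r)·Θ(t) + 4Rδ·t` while `b, c, ã ≥ 0`, `c ≤ Cm` (the rotor
  is internal to the pair; only the attenuator's return `μc²` and the forcing feed it);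
* `IsForcedWindow.clock_side` — THE CLOCK SIDE: if `c(0) = C`, `c₀ + δT < C`, `Θt ≤ r·c₀·T`,
  `b(0) + (εR² + δ)T ≤ B` (`B ≥ 0`), `C + L_c·Θt < Cm` with the trigger-ceiling slope
  `L_c = (νB + μR)/r + (σR² + δ)/(rc₀)` of `trigger_le_angle` (rate `νb - μa ≤ νB + μR`), the clock
  floor `b_low = b(0) - (νCm/r)Θt - δT ≥ 0` (`clock_ge_angle`) and the RATE INEQUALITY
  `μ²·(a(0)² + d(0)² + (2μRCm/r)Θt + 4RδT) ≤ ν²·b_low²` (so `νb ≥ μ|a| ≥ μa`: the trigger's net rate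
  stays `≥ 0`, `trigger_ge_affine` keeps `c ≥ C - δt > c₀`), then there is a time `t₁ ∈ (0, T]`
  with `Θ(t₁) = Θt` and, on `[0, t₁]`, `c₀ ≤ c ≤ Cm`, `Θ ≤ Θt`, `0 ≤ b ≤ B`.

Everything is stated for a given angle function `Θ` (`Θ(0) = 0`, right derivative `r·c`,
continuous), `|xᵢ| ≤ R` on the closed window and `ã ≥ 0` on the half-open one. The exit argument:
at the maximal time of `P`, the two trigger inequalities are STRICT, so `P` can only stop because
the angle target is met (or the horizon `T` is reached, where `Θ ≥ rc₀T ≥ Θt`).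
[cite: Tao2016AveragedNS, §5.5 Thm 5.3 (5.5) (third window: energy transfer)]
-/

noncomputable section

open Set Filter Topology
open scoped NNReal

namespace Literature.Analysis.FluidPDE.FluidComputer

open Literature.Analysis.FluidPDE.Tao2016AveragedNS Literature.Analysis.ODE

variable {ε σ ν μ r κ δ τ : ℝ} {x : ℝ → Fin 5 → ℝ} {Θ : ℝ → ℝ}

namespace IsForcedWindow

/-- **Clock ceiling**: while `|a| ≤ R` on `[0, τ)` (`ε, ν ≥ 0`), `b(t) ≤ b(0) + (εR² + δ)t`
(`∂ₜb = εa² - νc² + g_b ≤ εR² + δ`). [folklore] -/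
theorem clock_le_affine (h : IsForcedWindow ε σ ν μ r κ δ τ x) (hε : 0 ≤ ε) (hν : 0 ≤ ν)
    {R : ℝ} (haR : ∀ t ∈ Ico 0 τ, |x t 0| ≤ R) :
    ∀ t ∈ Icc 0 τ, x t 1 ≤ x 0 1 + (ε * R ^ 2 + δ) * t := by
  choose! V hV hVδ using h.defect
  have hcn : ContinuousOn (fun s => x s 1) (Icc 0 τ) :=
    (continuous_apply 1).comp_continuousOn h.continuousOn
  have hdv : ∀ s ∈ Ico 0 τ, HasDerivWithinAt (fun s => x s 1) (V s 1) (Ici s) s :=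
    fun s hs => (hasDerivWithinAt_pi.1 (hV s hs)) 1
  have hbd : ∀ s ∈ Ico 0 τ, V s 1 ≤ ε * R ^ 2 + δ := by
    intro s hs
    have hg := abs_apply_le_of_norm_le (hVδ s hs) 1
    rw [Pi.sub_apply, thresholdCircuit_apply_one] at hg
    have h1 := (abs_le.1 hg).2
    have haa := abs_le.1 (haR s hs)
    have ha2 : x s 0 ^ 2 ≤ R ^ 2 := sq_le_sq' haa.1 haa.2
    have e1 := mul_le_mul_of_nonneg_left ha2 hε
    have e2 : 0 ≤ ν * x s 2 ^ 2 := by positivity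
    linarith
  intro t ht
  have := sub_le_mul_of_deriv_right_le hcn hdv hbd t ht
  simp only [sub_zero] at this
  linarith

/-- **Carrier–conduit pair ceiling along the angle** (sign-free in `a` and `d`): while `b ≥ 0`,
`0 ≤ c ≤ Cm`, `ã ≥ 0` and `|xᵢ| ≤ R` on `[0, τ)` (`ε, σ, μ, κ ≥ 0`, `r > 0`),
`a(t)² + d(t)² ≤ a(0)² + d(0)² + (2μRCm/r)·Θ(t) + 4Rδ·t`: the rotor `r·c` is internal to the pair,
the pumps `-εab`, `-σac` and the drain `-κdã` only remove, the attenuator returns `2μac² ≤ 2μRCm·c`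
and the forcing costs `≤ 4Rδ`. [folklore] -/
theorem pairAD_le_angle (h : IsForcedWindow ε σ ν μ r κ δ τ x) (hε : 0 ≤ ε) (hσ : 0 ≤ σ)
    (hμ : 0 ≤ μ) (hr : 0 < r) (hκ : 0 ≤ κ) {R Cm : ℝ} (hR : 0 ≤ R) (hΘ0 : Θ 0 = 0)
    (hΘc : ContinuousOn Θ (Icc 0 τ))
    (hΘ' : ∀ t ∈ Ico 0 τ, HasDerivWithinAt Θ (r * x t 2) (Ici t) t)
    (hb : ∀ t ∈ Ico 0 τ, 0 ≤ x t 1) (hc : ∀ t ∈ Ico 0 τ, 0 ≤ x t 2 ∧ x t 2 ≤ Cm)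
    (he : ∀ t ∈ Ico 0 τ, 0 ≤ x t 4) (hRall : ∀ t ∈ Ico 0 τ, ∀ i, |x t i| ≤ R) :
    ∀ t ∈ Icc 0 τ, x t 0 ^ 2 + x t 3 ^ 2 ≤
      x 0 0 ^ 2 + x 0 3 ^ 2 + 2 * μ * R * Cm / r * Θ t + 4 * (R * δ) * t := by
  choose! V hV hVδ using h.defect
  set f : ℝ → ℝ := fun s => x s 0 ^ 2 + x s 3 ^ 2 - 2 * μ * R * Cm / r * Θ s with hf_def
  set f' : ℝ → ℝ := fun s => 2 * (x s 0 * V s 0) + 2 * (x s 3 * V s 3) -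
    2 * μ * R * Cm / r * (r * x s 2) with hf'_def
  have hfc : ContinuousOn f (Icc 0 τ) :=
    ((((continuous_apply 0).comp_continuousOn h.continuousOn).pow 2).add
      (((continuous_apply 3).comp_continuousOn h.continuousOn).pow 2)).sub
      (continuousOn_const.mul hΘc)
  have hfd : ∀ s ∈ Ico 0 τ, HasDerivWithinAt f (f' s) (Ici s) s := by
    intro s hs
    have h0 := ((hasDerivWithinAt_pi.1 (hV s hs)) 0).fun_pow 2
    have h3 := ((hasDerivWithinAt_pi.1 (hV s hs)) 3).fun_pow 2
    refine ((h0.add h3).sub ((hΘ' s hs).const_mul _)).congr_deriv ?_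
    simp only [hf'_def, show (2 : ℕ) - 1 = 1 from rfl, pow_one, Nat.cast_ofNat]; ring
  have hbd : ∀ s ∈ Ico 0 τ, f' s ≤ 4 * (R * δ) := by
    intro s hs
    have hg0 := abs_apply_le_of_norm_le (hVδ s hs) 0
    have hg3 := abs_apply_le_of_norm_le (hVδ s hs) 3
    rw [Pi.sub_apply, thresholdCircuit_apply_zero] at hg0
    rw [Pi.sub_apply, thresholdCircuit_apply_three] at hg3
    obtain ⟨hc0, hcC⟩ := hc s hs
    have ha := hRall s hs 0
    have hd := hRall s hs 3
    have f1 : |x s 0 * (V s 0 - (-(ε * x s 0 * x s 1) - σ * x s 0 * x s 2 + μ * x s 2 ^ 2 -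
        r * x s 3 * x s 2))| ≤ R * δ := by
      rw [abs_mul]; exact mul_le_mul ha hg0 (abs_nonneg _) ((abs_nonneg _).trans ha)
    have f2 : |x s 3 * (V s 3 - (r * x s 0 * x s 2 - κ * x s 3 * x s 4))| ≤ R * δ := by
      rw [abs_mul]; exact mul_le_mul hd hg3 (abs_nonneg _) ((abs_nonneg _).trans hd)
    have g1 := (abs_le.1 f1).2
    have g2 := (abs_le.1 f2).2
    have e0 : 2 * μ * R * Cm / r * (r * x s 2) = 2 * μ * R * Cm * x s 2 := by
      field_simp
    have e1 : f' s = 2 * (x s 0 * (V s 0 - (-(ε * x s 0 * x s 1) - σ * x s 0 * x s 2 +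
        μ * x s 2 ^ 2 - r * x s 3 * x s 2))) +
        2 * (x s 3 * (V s 3 - (r * x s 0 * x s 2 - κ * x s 3 * x s 4))) +
        (-(2 * ε * (x s 0 ^ 2 * x s 1)) - 2 * σ * (x s 0 ^ 2 * x s 2) +
          2 * μ * (x s 0 * x s 2 * x s 2) - 2 * κ * (x s 3 ^ 2 * x s 4)) -
        2 * μ * R * Cm / r * (r * x s 2) := by
      simp only [hf'_def]; ring
    have t1 : 0 ≤ 2 * ε * (x s 0 ^ 2 * x s 1) := by
      have := hb s hs; positivity
    have t2 : 0 ≤ 2 * σ * (x s 0 ^ 2 * x s 2) := by positivity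
    have t4 : 0 ≤ 2 * κ * (x s 3 ^ 2 * x s 4) := by
      have := he s hs; positivity
    have t3a : x s 0 * x s 2 ≤ R * Cm := by
      have h1 : x s 0 * x s 2 ≤ |x s 0| * x s 2 :=
        mul_le_mul_of_nonneg_right (le_abs_self _) hc0
      have h2 : |x s 0| * x s 2 ≤ R * Cm := mul_le_mul ha hcC hc0 hR
      linarith
    have t3 : x s 0 * x s 2 * x s 2 ≤ R * Cm * x s 2 := mul_le_mul_of_nonneg_right t3a hc0
    have t3' := mul_le_mul_of_nonneg_left t3 (by positivity : (0 : ℝ) ≤ 2 * μ)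
    rw [e1, e0]
    nlinarith [g1, g2, t1, t2, t3', t4]
  intro t ht
  have := sub_le_mul_of_deriv_right_le hfc hfd hbd t ht
  simp only [hf_def, hΘ0, mul_zero, sub_zero] at this
  linarith

set_option maxHeartbeats 400000 in
/-- **THE CLOCK SIDE of the transfer window** (see the module docstring): from ignition `c(0) = C`
and the listed design inequalities, the trigger stays in `[c₀, Cm]`, the clock in `[0, B]` and the
angle below `Θt` until a time `t₁ ∈ (0, T]` at which the angle target `Θt` is met. [folklore] -/
theorem clock_side (h : IsForcedWindow ε σ ν μ r κ δ τ x) (hε : 0 ≤ ε) (hσ : 0 ≤ σ) (hν : 0 ≤ ν)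
    (hμ : 0 ≤ μ) (hr : 0 < r) (hκ : 0 ≤ κ) (hδ : 0 ≤ δ) {R B C c₀ Cm Θt : ℝ} (hR : 0 ≤ R)
    (hB0 : 0 ≤ B) (hτ : 0 ≤ τ) (hc₀ : 0 < c₀) (hΘt : 0 < Θt) (hΘ0 : Θ 0 = 0)
    (hΘc : ContinuousOn Θ (Icc 0 τ))
    (hΘ' : ∀ t ∈ Ico 0 τ, HasDerivWithinAt Θ (r * x t 2) (Ici t) t)
    (hRall : ∀ t ∈ Icc 0 τ, ∀ i, |x t i| ≤ R) (hout : ∀ t ∈ Ico 0 τ, 0 ≤ x t 4)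
    (hcC : x 0 2 = C) (hfloor : c₀ + δ * τ < C) (hlong : Θt ≤ r * c₀ * τ)
    (hB : x 0 1 + (ε * R ^ 2 + δ) * τ ≤ B)
    (hCm : C + ((ν * B + μ * R) / r + (σ * R ^ 2 + δ) / (r * c₀)) * Θt < Cm)
    (hblow : 0 ≤ x 0 1 - ν * Cm / r * Θt - δ * τ)
    (hrate : μ ^ 2 * (x 0 0 ^ 2 + x 0 3 ^ 2 + 2 * μ * R * Cm / r * Θt + 4 * (R * δ) * τ) ≤
      ν ^ 2 * (x 0 1 - ν * Cm / r * Θt - δ * τ) ^ 2) :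
    ∃ t₁ ∈ Ioc 0 τ, Θ t₁ = Θt ∧ ∀ t ∈ Icc 0 t₁,
      (c₀ ≤ x t 2 ∧ x t 2 ≤ Cm) ∧ Θ t ≤ Θt ∧ 0 ≤ x t 1 ∧ x t 1 ≤ B := by
  -- the slope of the trigger ceiling and the signs of the constants
  set Lc := (ν * B + μ * R) / r + (σ * R ^ 2 + δ) / (r * c₀) with hLc_def
  have hLc : 0 ≤ Lc := by positivity
  have hC : 0 < C := by nlinarith [mul_nonneg hδ hτ]
  have hCmC : C < Cm := by nlinarith [mul_nonneg hLc hΘt.le]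
  have hCm0 : 0 ≤ Cm := by linarith
  -- the bootstrap condition and its maximal time
  set P : ℝ → Prop := fun t => c₀ ≤ x t 2 ∧ x t 2 ≤ Cm ∧ Θ t ≤ Θt with hP_def
  have hP0 : P 0 := by
    refine ⟨?_, ?_, ?_⟩
    · rw [hcC]; nlinarith [mul_nonneg hδ hτ]
    · rw [hcC]; exact hCmC.le
    · rw [hΘ0]; exact hΘt.le
  have hcc : ContinuousOn (fun s => x s 2) (Icc 0 τ) :=
    (continuous_apply 2).comp_continuousOn h.continuousOn
  have hclosed : ∀ t ∈ Ioc 0 τ, (∀ s ∈ Ico 0 t, P s) → P t := by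
    intro t ht hst
    refine ⟨?_, ?_, ?_⟩
    · have := le_const_of_forall_Ico (g := fun s => -x s 2) (C := -c₀) hcc.neg ht
        (fun s hs => by have := (hst s hs).1; show -x s 2 ≤ -c₀; linarith)
      have h' : -x t 2 ≤ -c₀ := this
      linarith
    · exact le_const_of_forall_Ico (g := fun s => x s 2) hcc ht (fun s hs => (hst s hs).2.1)
    · exact le_const_of_forall_Ico (g := Θ) hΘc ht (fun s hs => (hst s hs).2.2)
  set t₁ := maximalTimeP P 0 τ with ht₁_def
  have ht₁mem : t₁ ∈ Icc 0 τ := maximalTimeP_mem hτ hP0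
  have hPt : ∀ t ∈ Icc 0 t₁, P t := fun t ht => maximalTimeP_spec hτ hP0 hclosed ht
  -- the window `[0, t₁]`
  have hW := h.mono ht₁mem.2
  have hIco : ∀ t ∈ Ico 0 t₁, t ∈ Ico 0 τ := fun t ht => ⟨ht.1, lt_of_lt_of_le ht.2 ht₁mem.2⟩
  have hIcc : ∀ t ∈ Icc 0 t₁, t ∈ Icc 0 τ := fun t ht => ⟨ht.1, ht.2.trans ht₁mem.2⟩
  have hΘcW : ContinuousOn Θ (Icc 0 t₁) := hΘc.mono (Icc_subset_Icc_right ht₁mem.2)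
  have hΘ'W : ∀ t ∈ Ico 0 t₁, HasDerivWithinAt Θ (r * x t 2) (Ici t) t :=
    fun t ht => hΘ' t (hIco t ht)
  have hcW : ∀ t ∈ Ico 0 t₁, 0 ≤ x t 2 ∧ x t 2 ≤ Cm := fun t ht =>
    ⟨hc₀.le.trans (hPt t (Ico_subset_Icc_self ht)).1, (hPt t (Ico_subset_Icc_self ht)).2.1⟩
  have hRW : ∀ t ∈ Ico 0 t₁, ∀ i, |x t i| ≤ R := fun t ht i =>
    hRall t (hIcc t (Ico_subset_Icc_self ht)) i
  -- (D1) the clock floor: `b ≥ b_low ≥ 0`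
  have hbl : ∀ t ∈ Icc 0 t₁, x 0 1 - ν * Cm / r * Θt - δ * τ ≤ x t 1 := by
    intro t ht
    have h1 := hW.clock_ge_angle hε hν hr hΘ0 hΘcW hΘ'W hcW t ht
    have h2 : ν * Cm / r * Θ t ≤ ν * Cm / r * Θt :=
      mul_le_mul_of_nonneg_left (hPt t ht).2.2 (by positivity)
    have h3 : δ * t ≤ δ * τ := mul_le_mul_of_nonneg_left (ht.2.trans ht₁mem.2) hδ
    linarith
  have hb0 : ∀ t ∈ Icc 0 t₁, 0 ≤ x t 1 := fun t ht => hblow.trans (hbl t ht)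
  -- (D2) the clock ceiling: `b ≤ B`
  have hbB : ∀ t ∈ Icc 0 t₁, x t 1 ≤ B := by
    intro t ht
    have h1 := hW.clock_le_affine hε hν (fun s hs => hRW s hs 0) t ht
    have h2 : (ε * R ^ 2 + δ) * t ≤ (ε * R ^ 2 + δ) * τ :=
      mul_le_mul_of_nonneg_left (ht.2.trans ht₁mem.2) (by positivity)
    linarith
  -- (D3) the pair ceiling
  have hpair : ∀ t ∈ Icc 0 t₁, x t 0 ^ 2 + x t 3 ^ 2 ≤
      x 0 0 ^ 2 + x 0 3 ^ 2 + 2 * μ * R * Cm / r * Θt + 4 * (R * δ) * τ := by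
    intro t ht
    have h1 := hW.pairAD_le_angle hε hσ hμ hr hκ hR hΘ0 hΘcW hΘ'W
      (fun s hs => hb0 s (Ico_subset_Icc_self hs)) hcW (fun s hs => hout s (hIco s hs)) hRW t ht
    have h2 : 2 * μ * R * Cm / r * Θ t ≤ 2 * μ * R * Cm / r * Θt :=
      mul_le_mul_of_nonneg_left (hPt t ht).2.2 (by positivity)
    have h3 : 4 * (R * δ) * t ≤ 4 * (R * δ) * τ :=
      mul_le_mul_of_nonneg_left (ht.2.trans ht₁mem.2) (by positivity)
    linarith
  -- (D4) the net rate stays `≥ 0`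
  have hrate0 : ∀ t ∈ Icc 0 t₁, 0 ≤ ν * x t 1 - μ * x t 0 := by
    intro t ht
    have hbl0 : 0 ≤ x 0 1 - ν * Cm / r * Θt - δ * τ := hblow
    have hνb : ν * (x 0 1 - ν * Cm / r * Θt - δ * τ) ≤ ν * x t 1 :=
      mul_le_mul_of_nonneg_left (hbl t ht) hν
    have ha2 : x t 0 ^ 2 ≤ x 0 0 ^ 2 + x 0 3 ^ 2 + 2 * μ * R * Cm / r * Θt + 4 * (R * δ) * τ := by
      nlinarith [hpair t ht, sq_nonneg (x t 3)]
    have h1 : (μ * x t 0) ^ 2 ≤ (ν * (x 0 1 - ν * Cm / r * Θt - δ * τ)) ^ 2 := by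
      have h2 := mul_le_mul_of_nonneg_left ha2 (sq_nonneg μ)
      calc (μ * x t 0) ^ 2 = μ ^ 2 * x t 0 ^ 2 := by ring
        _ ≤ μ ^ 2 * (x 0 0 ^ 2 + x 0 3 ^ 2 + 2 * μ * R * Cm / r * Θt + 4 * (R * δ) * τ) := h2
        _ ≤ ν ^ 2 * (x 0 1 - ν * Cm / r * Θt - δ * τ) ^ 2 := hrate
        _ = (ν * (x 0 1 - ν * Cm / r * Θt - δ * τ)) ^ 2 := by ring
    have h3 : |μ * x t 0| ≤ |ν * (x 0 1 - ν * Cm / r * Θt - δ * τ)| := sq_le_sq.1 h1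
    rw [abs_of_nonneg (mul_nonneg hν hbl0)] at h3
    have h4 := (le_abs_self _).trans h3
    linarith
  -- (D5) the trigger floor `c ≥ C - δt`
  have hcfl : ∀ t ∈ Icc 0 t₁, C - δ * t ≤ x t 2 := by
    intro t ht
    have := hW.trigger_ge_affine hσ (fun s hs => hrate0 s (Ico_subset_Icc_self hs))
      (fun s hs => (hcW s hs).1) t ht
    rw [hcC] at this
    exact this
  -- (D6) the trigger ceiling `c ≤ C + L_c Θ`
  have hratele : ∀ s ∈ Ico 0 t₁, ν * x s 1 - μ * x s 0 ≤ ν * B + μ * R := by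
    intro s hs
    have h1 : ν * x s 1 ≤ ν * B := mul_le_mul_of_nonneg_left (hbB s (Ico_subset_Icc_self hs)) hν
    have h2 : -x s 0 ≤ R := (neg_le_abs _).trans (hRW s hs 0)
    have h3 := mul_le_mul_of_nonneg_left h2 hμ
    linarith
  have hcle : ∀ t ∈ Icc 0 t₁, x t 2 ≤ C + Lc * Θ t := by
    intro t ht
    have := hW.trigger_le_angle hσ hr hδ hc₀ hΘ0 hΘcW hΘ'W (fun s hs => hRW s hs 0) hratele
      (fun s hs => (hPt s (Ico_subset_Icc_self hs)).1) t ht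
    rw [hcC] at this
    exact this
  -- exit: the angle target is met at `t₁`
  have hΘt₁ : Θ t₁ = Θt := by
    have hle : Θ t₁ ≤ Θt := (hPt t₁ ⟨ht₁mem.1, le_rfl⟩).2.2
    refine le_antisymm hle ?_
    by_contra hlt
    push Not at hlt
    rcases eq_or_lt_of_le ht₁mem.2 with heq | hltτ
    · -- `t₁ = τ`: the angle has grown at least like `r c₀ τ ≥ Θt`
      have hang := angle_ge_mul hr.le hΘ0 hΘcW hΘ'W
        (fun s hs => (hPt s (Ico_subset_Icc_self hs)).1) t₁ ⟨ht₁mem.1, le_rfl⟩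
      rw [heq] at hang hlt
      linarith
    · -- `t₁ < τ`: both trigger inequalities are strict at `t₁`, so `P` persists — contradiction
      have hct₁lo : c₀ < x t₁ 2 := by
        have h1 := hcfl t₁ ⟨ht₁mem.1, le_rfl⟩
        have h2 : δ * t₁ ≤ δ * τ := mul_le_mul_of_nonneg_left ht₁mem.2 hδ
        linarith
      have hct₁hi : x t₁ 2 < Cm := by
        have h1 := hcle t₁ ⟨ht₁mem.1, le_rfl⟩
        have h2 : Lc * Θ t₁ ≤ Lc * Θt := mul_le_mul_of_nonneg_left hle hLc
        linarith
      have hev : ∀ᶠ t in 𝓝[Icc 0 τ] t₁, P t := by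
        have e1 := (hcc t₁ ht₁mem).eventually_const_lt hct₁lo
        have e2 := (hcc t₁ ht₁mem).eventually_lt_const hct₁hi
        have e3 := (hΘc t₁ ht₁mem).eventually_lt_const hlt
        exact (e1.and (e2.and e3)).mono fun t ht => ⟨ht.1.le, ht.2.1.le, ht.2.2.le⟩
      exact not_eventually_of_maximalTimeP_lt hτ hP0 hltτ hev
  have ht₁pos : 0 < t₁ := by
    rcases eq_or_lt_of_le ht₁mem.1 with h0 | h0
    · exfalso
      rw [← h0, hΘ0] at hΘt₁
      linarith
    · exact h0
  exact ⟨t₁, ⟨ht₁pos, ht₁mem.2⟩, hΘt₁, fun t ht =>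
    ⟨⟨(hPt t ht).1, (hPt t ht).2.1⟩, (hPt t ht).2.2, hb0 t ht, hbB t ht⟩⟩

end IsForcedWindow

end Literature.Analysis.FluidPDE.FluidComputer

end
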